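import Mathlib.Analysis.InnerProductSpace.Basic
import Mathlib.Analysis.InnerProductSpace.PiL2
import Mathlib.Analysis.Convex.Contractible
import Mathlib.Analysis.Convex.PathConnected
import Mathlib.Analysis.Normed.Module.Convex
import Mathlib.Topology.Homotopy.Contractible
import Mathlib.Topology.UnitInterval
import Mathlib.Topology.MetricSpace.Pseudo.Lemmas
import Mathlib.AlgebraicTopology.FundamentalGroupoid.FundamentalGroup
import Mathlib.GroupTheory.Finiteness
import Literature.AlgebraicTopology.FundamentalGroup.FiniteCover
import Literature.Topology.FourManifolds.GluckTwistProofs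
import Literature.Topology.FourManifolds.KnotGroupProofs
import Literature.Topology.FourManifolds.DehnSurgery
import HarnessLib

/-!
# Knot groups are finitely generated: reduction to the existence of a tubular neighbourhood

Sibling proof file of `KnotGroup.lean` / `KnotGroupProofs.lean` (D-0014: named facts
`def X : Prop` are discharged as `theorem X_holds : X`, bottom-up). `KnotGroupProofs.lean` reduced
the named fact `Literature.Topology.FourManifolds.Knot.IsAlexanderPolynomial.isUnit_eval_one` (`Δ_K(1) = ±1`, Crowell–Fox Ch. IX
(1.1)–(1.2)) to the named fact `Literature.Topology.FourManifolds.Knot.fg_group` (knot groups are finitely generated, Crowell–Fox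
Ch. VI (2.5)). This file proves the topological step

* `Literature.Knot.fg_group_of_nonempty_tubularNbhd : Knot.nonempty_tubularNbhd → Knot.fg_group`, hence
* `Literature.Knot.IsAlexanderPolynomial.isUnit_eval_one_of_nonempty_tubularNbhd :
    Knot.nonempty_tubularNbhd → Knot.IsAlexanderPolynomial.isUnit_eval_one`,

so that both facts now rest on the single named fact `Literature.Topology.FourManifolds.Knot.nonempty_tubularNbhd`
(`DehnSurgery.lean`; the tubular neighbourhood theorem for knots in `S³`, Hirsch (1976), §4.5
Thm. 5.2), itself the remaining leaf.

## The argument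

The classical proof that a knot group is finitely generated reads a finite (Wirtinger / over)
presentation off a regular projection (Crowell–Fox, Ch. VI; Rolfsen, *Knots and Links*, §3.D);
alternatively the knot exterior is a compact 3-manifold. Both need the local product structure of
`S³` near the knot. We use it in the following elementary form, which needs nothing beyond point-set
topology once a tube is given.

**Theorem** (`Literature.Topology.FourManifolds.fundamentalGroup_fg_compl_range_of_tube`). Let `ν : S¹ × ℝ² → S³` be continuous,
injective and open with core `k = ν (·, 0)`. Then `π₁(S³ ∖ k(S¹), x₀)` is finitely generated for
every `x₀`.

*Proof.* By the finite-cover generation theorem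
`Literature.AlgebraicTopology.FundamentalGroup.fundamentalGroup_fg_of_finite_cover_of_isSimplyConnected` (`FiniteCover.lean`: if an open set
`U` is covered by finitely many open path-connected `W i ⊆ U` such that any two meeting pieces lie
in a simply connected `R ⊆ U`, then `π₁(U)` is finitely generated — the Lebesgue-number half of
van Kampen's theorem) applied to the following cover of `U = S³ ∖ k(S¹)`:

* sixteen *tube pieces* `ν (A_a × (H_b ∩ B(0, 2)))`, `A_a ⊆ S¹` the four open coordinate
  half-circles and `H_b ⊆ ℝ²` the four open coordinate half-planes (they cover `ν (S¹ × B(0, 1))`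
  minus the core, since every nonzero vector of `ℝ²` has a coordinate of definite sign);
* finitely many *far balls* `B(c, δ)` (chordal metric of `S³ ⊆ ℝ⁴`) centred on the compact set
  `C = S³ ∖ ν (S¹ × B(0, 1))` (`ν` is open), where `3δ ≤ 1` is at most a Lebesgue number of the open
  cover of `C` by `S³ ∖ ν (S¹ × B̄(0, 2))` and the enlarged pieces `ν (A_a × (H_b ∩ B(0, 3)))`.

Containers: two meeting tube pieces share a point `ν (z, u)` and lie in
`ν ((S¹ ∖ {-z}) × ((H_b ∪ H_b') ∩ B(0, 3)))`, the homeomorphic image (`ν` is an embedding) of the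
product of a contractible cap of `S¹` and a set star-shaped about `u`; a far ball meeting a tube
piece has `B(c, 3δ)` inside an enlarged tube piece (it cannot lie in `S³ ∖ ν (S¹ × B̄(0, 2))`), and
the same container works; two meeting far balls lie in `B(c, 3δ)`, which is a cap of `S³`, hence
contractible, and lies in a member of the cover of `C`, hence in `U`.

The geometric inputs are proved here in general form: open caps `{x ∈ S | s₀ < ⟪x, c⟫}`
(`-1 ≤ s₀ < 1`) of the unit sphere of a real inner product space are contractible
(`Literature.Topology.FourManifolds.contractibleSpace_sphereCap`, contraction along normalised chords), metric balls of the unit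
sphere are caps (`Literature.Topology.FourManifolds.ball_sphere_eq_sphereCap`), open half-spaces are convex. That a tubular
neighbourhood `ν : S¹ × ℝ² → S³` (`Literature.Topology.FourManifolds.Knot.TubularNbhd`, a smooth embedding) is an open map is
invariance of domain for immersions between equidimensional manifolds
(`Literature.Topology.FourManifolds.Manifold.IsSmoothEmbedding.isOpenMap_of_finrank_eq`, `GluckTwistProofs.lean`).

## Sources

R. H. Crowell, R. H. Fox, *Introduction to Knot Theory* (1963; GTM 57, 1977), Ch. VI (2.5) (knot
groups are finitely presented), Ch. IX (1.1)–(1.2) (`Δ(1) = ±1`); D. Rolfsen, *Knots and Links*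
(1976), §3.D, §8.C; M. W. Hirsch, *Differential Topology* (1976), §4.5 Thm. 5.2 (tubular
neighbourhoods); A. Hatcher, *Algebraic Topology* (2002), §1.2 (van Kampen). The cover-by-pieces
argument in the present form is folklore. No new definitions or named facts are introduced.
-/

noncomputable section

open Set Function Filter Topology unitInterval RealInnerProductSpace
open scoped Manifold ContDiff

namespace Literature.Topology.FourManifolds

/-! ## Open caps of round spheres are contractible -/

section Cap

/-- The elementary inequality behind the contraction of caps: along the chord from a unit vector
`x` to a unit vector `c` (`s = ⟪x, c⟫`, `N = ‖(1 - t) x + t c‖`), the inner product with `c` of the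
normalised point does not decrease: `s N ≤ (1 - t) s + t`. [folklore] -/
theorem sphereCap_aux {s t N : ℝ} (hs : -1 ≤ s) (hs' : s ≤ 1) (ht : 0 ≤ t) (ht' : t ≤ 1)
    (hN : 0 ≤ N) (hN2 : N ^ 2 = (1 - t) ^ 2 + t ^ 2 + 2 * t * (1 - t) * s) :
    s * N ≤ (1 - t) * s + t := by
  have hN1 : N ≤ 1 := by
    have h0 : 0 ≤ t * (1 - t) * (1 - s) :=
      mul_nonneg (mul_nonneg ht (sub_nonneg.2 ht')) (sub_nonneg.2 hs')
    have : N ^ 2 ≤ 1 := by rw [hN2]; nlinarith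
    nlinarith
  by_cases hs0 : 0 ≤ s
  · nlinarith
  · replace hs0 : s < 0 := not_le.1 hs0
    by_cases hA : 0 ≤ (1 - t) * s + t
    · nlinarith
    · replace hA : (1 - t) * s + t < 0 := not_le.1 hA
      -- both sides negative: compare squares
      have hsq : ((1 - t) * s + t) ^ 2 ≤ (s * N) ^ 2 := by
        have : ((1 - t) * s + t) ^ 2 - (s * N) ^ 2 = t * (1 - s ^ 2) * (2 * (1 - t) * s + t) := by
          rw [mul_pow, hN2]; ring
        have h3 : 2 * (1 - t) * s + t < 0 := by nlinarith
        have h4 : 0 ≤ t * (1 - s ^ 2) := mul_nonneg ht (by nlinarith)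
        have h5 : 0 ≤ t * (1 - s ^ 2) * -(2 * (1 - t) * s + t) := mul_nonneg h4 (by linarith)
        nlinarith
      have hsN : s * N ≤ 0 := mul_nonpos_of_nonpos_of_nonneg hs0.le hN
      have hprod : 0 ≤ (s * N - ((1 - t) * s + t)) * (s * N + ((1 - t) * s + t)) := by
        nlinarith [hsq]
      by_contra hcon
      replace hcon := not_le.1 hcon
      nlinarith

variable {V : Type*} [NormedAddCommGroup V] [InnerProductSpace ℝ V]

/-- Contraction of a cap along normalised chords: for unit vectors `x`, `c` with `-1 < ⟪x, c⟫`
(i.e. `x ≠ -c`) and `t ∈ [0, 1]`, the chord point `w = (1 - t) x + t c` is nonzero and the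
normalised point `w / ‖w‖` satisfies `⟪x, c⟫ ≤ ⟪w / ‖w‖, c⟫`. [folklore] -/
theorem sphereCap_chord {x c : V} (hx : ‖x‖ = 1) (hc : ‖c‖ = 1) (hxc : -1 < ⟪x, c⟫) {t : ℝ}
    (ht : 0 ≤ t) (ht' : t ≤ 1) :
    (1 - t) • x + t • c ≠ 0 ∧
      ⟪x, c⟫ ≤ ⟪‖(1 - t) • x + t • c‖⁻¹ • ((1 - t) • x + t • c), c⟫ := by
  set s := ⟪x, c⟫ with hs_def
  set w := (1 - t) • x + t • c with hw_def
  have hcc : ⟪c, c⟫ = 1 := by rw [real_inner_self_eq_norm_sq, hc, one_pow]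
  have hxx : ⟪x, x⟫ = 1 := by rw [real_inner_self_eq_norm_sq, hx, one_pow]
  have hwc : ⟪w, c⟫ = (1 - t) * s + t := by
    simp only [hw_def, inner_add_left, real_inner_smul_left, hcc, hs_def]; ring
  have hwx : ⟪w, x⟫ = (1 - t) + t * s := by
    simp only [hw_def, inner_add_left, real_inner_smul_left, hxx, hs_def, real_inner_comm c x]
    ring
  have hs1 : s ≤ 1 := by
    have := real_inner_le_norm x c; rwa [hx, hc, one_mul] at this
  have hw0 : w ≠ 0 := by
    intro h
    have h1 : ⟪w, x + c⟫ = 1 + s := by rw [inner_add_right, hwx, hwc]; ring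
    rw [h, inner_zero_left] at h1
    linarith
  have hN2 : ‖w‖ ^ 2 = (1 - t) ^ 2 + t ^ 2 + 2 * t * (1 - t) * s := by
    rw [hw_def, norm_add_sq_real, norm_smul, norm_smul, hx, hc, real_inner_smul_left,
      real_inner_smul_right, Real.norm_of_nonneg ht, Real.norm_of_nonneg (by linarith), ← hs_def]
    ring
  refine ⟨hw0, ?_⟩
  have hNpos : 0 < ‖w‖ := norm_pos_iff.2 hw0
  rw [real_inner_smul_left, hwc]
  have key := sphereCap_aux hxc.le hs1 ht ht' hNpos.le hN2
  rw [le_inv_mul_iff₀ hNpos]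
  linarith

/-- **Open caps of the unit sphere are contractible**: for a unit vector `c` and `-1 ≤ s₀ < 1` the
cap `{x ∈ S | s₀ < ⟪x, c⟫}` of the unit sphere `S` (which does not contain `-c`) contracts to `c`
along normalised chords `(t, x) ↦ ((1 - t) x + t c) / ‖(1 - t) x + t c‖`. Covers open hemispheres
(`s₀ = 0`), metric balls of the sphere of chordal radius `≤ 2`, and the sphere minus a point
(`s₀ = -1`). [folklore] -/
theorem contractibleSpace_sphereCap {c : V} (hc : ‖c‖ = 1) {s₀ : ℝ} (h₁ : -1 ≤ s₀) (h₂ : s₀ < 1) :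
    ContractibleSpace ↥{x : Metric.sphere (0 : V) 1 | s₀ < ⟪(x : V), c⟫} := by
  set C : Set (Metric.sphere (0 : V) 1) := {x | s₀ < ⟪(x : V), c⟫} with hC_def
  have hcS : c ∈ Metric.sphere (0 : V) 1 := by simp [hc]
  have hcc : ⟪c, c⟫ = 1 := by rw [real_inner_self_eq_norm_sq, hc, one_pow]
  have hcC : (⟨c, hcS⟩ : Metric.sphere (0 : V) 1) ∈ C := by
    show s₀ < ⟪c, c⟫; rw [hcc]; exact h₂
  -- the contraction
  let w : I × C → V := fun p => (1 - (p.1 : ℝ)) • ((p.2 : Metric.sphere (0 : V) 1) : V)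
    + (p.1 : ℝ) • c
  have hw : Continuous w := by fun_prop
  have hmem : ∀ p : I × C, -1 < ⟪(((p.2 : Metric.sphere (0 : V) 1)) : V), c⟫ :=
    fun p => lt_of_le_of_lt h₁ p.2.2
  have hnorm : ∀ p : I × C, ‖(((p.2 : Metric.sphere (0 : V) 1)) : V)‖ = 1 :=
    fun p => by simp
  have hw0 : ∀ p, w p ≠ 0 := fun p =>
    (sphereCap_chord (hnorm p) hc (hmem p) p.1.2.1 p.1.2.2).1
  let Hv : I × C → V := fun p => ‖w p‖⁻¹ • w p
  have hHv : Continuous Hv := (Continuous.inv₀ (hw.norm) (fun p => norm_ne_zero_iff.2 (hw0 p))).smul hw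
  have hHs : ∀ p, Hv p ∈ Metric.sphere (0 : V) 1 := fun p => by
    simp only [Hv, mem_sphere_iff_norm, sub_zero, norm_smul, norm_inv, norm_norm]
    exact inv_mul_cancel₀ (norm_ne_zero_iff.2 (hw0 p))
  have hHc : ∀ p, (⟨Hv p, hHs p⟩ : Metric.sphere (0 : V) 1) ∈ C := fun p => by
    show s₀ < ⟪‖w p‖⁻¹ • w p, c⟫
    exact lt_of_lt_of_le p.2.2 (sphereCap_chord (hnorm p) hc (hmem p) p.1.2.1 p.1.2.2).2
  let H : C(I × C, C) := ⟨fun p => ⟨⟨Hv p, hHs p⟩, hHc p⟩, (hHv.subtype_mk _).subtype_mk _⟩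
  refine (contractible_iff_id_nullhomotopic _).2 ⟨⟨⟨c, hcS⟩, hcC⟩, ⟨?_⟩⟩
  refine { toContinuousMap := H, map_zero_left := ?_, map_one_left := ?_ }
  · intro y
    apply Subtype.ext; apply Subtype.ext
    show ‖w (0, y)‖⁻¹ • w (0, y) = _
    have : w (0, y) = ((y : Metric.sphere (0 : V) 1) : V) := by simp [w]
    rw [this, hnorm (0, y), inv_one, one_smul]
    rfl
  · intro y
    apply Subtype.ext; apply Subtype.ext
    show ‖w (1, y)‖⁻¹ • w (1, y) = c
    have : w (1, y) = c := by simp [w]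
    rw [this, hc, inv_one, one_smul]

/-- Open caps are open subsets of the sphere. [folklore] -/
theorem isOpen_sphereCap (c : V) (s₀ : ℝ) :
    IsOpen {x : Metric.sphere (0 : V) 1 | s₀ < ⟪(x : V), c⟫} :=
  isOpen_lt continuous_const (continuous_subtype_val.inner continuous_const)

/-- Open caps (with `-1 ≤ s₀ < 1`) are path connected. [folklore] -/
theorem isPathConnected_sphereCap {c : V} (hc : ‖c‖ = 1) {s₀ : ℝ} (h₁ : -1 ≤ s₀) (h₂ : s₀ < 1) :
    IsPathConnected {x : Metric.sphere (0 : V) 1 | s₀ < ⟪(x : V), c⟫} := by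
  haveI := contractibleSpace_sphereCap hc h₁ h₂
  exact isPathConnected_iff_pathConnectedSpace.2 inferInstance

/-- Two points of an open hemisphere `{0 < ⟪·, v⟫}` of the unit sphere are not antipodal:
`-1 < ⟪x, z⟫`. [folklore] -/
theorem neg_one_lt_inner_of_inner_pos {v : V} {x z : Metric.sphere (0 : V) 1}
    (hx : 0 < ⟪(x : V), v⟫) (hz : 0 < ⟪(z : V), v⟫) : -1 < ⟪(x : V), (z : V)⟫ := by
  have hx1 : ‖(x : V)‖ = 1 := by simp
  have hz1 : ‖(z : V)‖ = 1 := by simp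
  have hle : -1 ≤ ⟪(x : V), (z : V)⟫ := by
    have := neg_le_of_abs_le (abs_real_inner_le_norm (x : V) (z : V))
    rwa [hx1, hz1, one_mul] at this
  refine lt_of_le_of_ne hle fun h => ?_
  -- `⟪x, z⟫ = -1` forces `x = -z`, contradicting `0 < ⟪x, v⟫` and `0 < ⟪z, v⟫`
  have hsum : (x : V) + z = 0 := by
    have : ‖(x : V) + z‖ ^ 2 = 0 := by
      rw [norm_add_sq_real, hx1, hz1, ← h]; ring
    exact norm_eq_zero.1 (pow_eq_zero_iff (n := 2) two_ne_zero |>.1 this)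
  have hxz : (x : V) = -z := eq_neg_of_add_eq_zero_left hsum
  rw [hxz, inner_neg_left] at hx
  linarith

/-- Metric balls of the unit sphere (chordal metric) are caps:
`B(c, r) = {x | 1 - r² / 2 < ⟪x, c⟫}` for `0 < r`. [folklore] -/
theorem ball_sphere_eq_sphereCap (c : Metric.sphere (0 : V) 1) {r : ℝ} (hr : 0 < r) :
    Metric.ball c r = {x : Metric.sphere (0 : V) 1 | 1 - r ^ 2 / 2 < ⟪(x : V), (c : V)⟫} := by
  ext x
  rw [Metric.mem_ball, Subtype.dist_eq, dist_eq_norm, mem_setOf_eq]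
  have hx1 : ‖(x : V)‖ = 1 := by simp
  have hc1 : ‖(c : V)‖ = 1 := by simp
  have hsq : ‖(x : V) - c‖ ^ 2 = 2 - 2 * ⟪(x : V), (c : V)⟫ := by
    rw [norm_sub_sq_real, hx1, hc1]; ring
  constructor
  · intro h
    have : ‖(x : V) - c‖ ^ 2 < r ^ 2 := by gcongr
    linarith
  · intro h
    have h2 : ‖(x : V) - c‖ ^ 2 < r ^ 2 := by linarith
    exact lt_of_pow_lt_pow_left₀ 2 hr.le h2

/-- Metric balls of chordal radius `0 < r ≤ 2` in the unit sphere are contractible. [folklore] -/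
theorem contractibleSpace_ball_sphere (c : Metric.sphere (0 : V) 1) {r : ℝ} (hr : 0 < r)
    (hr2 : r ≤ 2) : ContractibleSpace (Metric.ball c r) := by
  rw [ball_sphere_eq_sphereCap c hr]
  refine contractibleSpace_sphereCap (by simp) ?_ ?_
  · nlinarith
  · nlinarith

/-- Metric balls of chordal radius `0 < r ≤ 2` in the unit sphere are path connected. [folklore] -/
theorem isPathConnected_ball_sphere (c : Metric.sphere (0 : V) 1) {r : ℝ} (hr : 0 < r)
    (hr2 : r ≤ 2) : IsPathConnected (Metric.ball c r) := by
  haveI := contractibleSpace_ball_sphere c hr hr2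
  exact isPathConnected_iff_pathConnectedSpace.2 inferInstance

/-! ## Open half-spaces -/

/-- Open half-spaces `{0 < ⟪·, v⟫}` are open. [folklore] -/
theorem isOpen_setOf_inner_pos (v : V) : IsOpen {u : V | 0 < ⟪u, v⟫} :=
  isOpen_lt continuous_const (continuous_id.inner continuous_const)

/-- Open half-spaces `{0 < ⟪·, v⟫}` are convex. [folklore] -/
theorem convex_setOf_inner_pos (v : V) : Convex ℝ {u : V | 0 < ⟪u, v⟫} := by
  have : {u : V | 0 < ⟪u, v⟫} = (innerSL ℝ v : V →ₗ[ℝ] ℝ) ⁻¹' Ioi 0 := by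
    ext u; simp [real_inner_comm]
  rw [this]
  exact (convex_Ioi 0).linear_preimage _

/-- The union of two open half-spaces through `0`, cut down to a ball around `0`, is star-shaped
about any point common to both (hence contractible). [folklore] -/
theorem starConvex_union_setOf_inner_pos_inter_ball {v v' u : V} (hu : 0 < ⟪u, v⟫)
    (hu' : 0 < ⟪u, v'⟫) {r : ℝ} (hur : ‖u‖ < r) :
    StarConvex ℝ u (({w : V | 0 < ⟪w, v⟫} ∪ {w : V | 0 < ⟪w, v'⟫}) ∩ Metric.ball 0 r) := by
  have hur' : u ∈ Metric.ball (0 : V) r := by rwa [Metric.mem_ball, dist_zero_right]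
  rw [union_inter_distrib_right]
  exact (((convex_setOf_inner_pos v).inter (convex_ball 0 r)).starConvex ⟨hu, hur'⟩).union
    (((convex_setOf_inner_pos v').inter (convex_ball 0 r)).starConvex ⟨hu', hur'⟩)

end Cap

/-! ## The complement of the core of a tube in `S³` -/

section Tube

/-- Local notation: `𝔼 n` is the model Euclidean space `EuclideanSpace ℝ (Fin n)`. -/
local notation "𝔼 " n:arg => EuclideanSpace ℝ (Fin n)

/-- Local notation: `𝕊 n` is the unit sphere in `EuclideanSpace ℝ (Fin (n + 1))`. -/
local notation "𝕊 " n:arg => (Metric.sphere (0 : EuclideanSpace ℝ (Fin (n + 1))) 1)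

/-- Every nonzero vector of `ℝ²` has a coordinate of definite sign: it lies in one of the four open
coordinate half-planes `{0 < ⟪·, ± eᵢ⟫}` (indexed by `(i, σ) : Fin 2 × Fin 2`, sign `+` for
`σ = 0`). [folklore] -/
theorem exists_inner_single_pos {u : 𝔼 2} (hu : u ≠ 0) :
    ∃ d : Fin 2 × Fin 2,
      0 < ⟪u, EuclideanSpace.single d.1 (if d.2 = 0 then (1 : ℝ) else -1)⟫ := by
  have : ∃ i, u i ≠ 0 := by
    by_contra h
    push Not at h
    exact hu (PiLp.ext fun i => by simpa using h i)
  obtain ⟨i, hi⟩ := this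
  rcases lt_or_gt_of_ne hi with h | h
  · refine ⟨(i, 1), ?_⟩
    rw [EuclideanSpace.inner_single_right]
    simp; linarith
  · refine ⟨(i, 0), ?_⟩
    rw [EuclideanSpace.inner_single_right]
    simp; linarith

/-- The four coordinate unit vectors `± eᵢ` of `ℝ²` have norm one. [folklore] -/
theorem norm_single_sign (d : Fin 2 × Fin 2) :
    ‖(EuclideanSpace.single d.1 (if d.2 = 0 then (1 : ℝ) else -1) : 𝔼 2)‖ = 1 := by
  split_ifs <;> simp

variable {ν : (𝕊 1) × 𝔼 2 → 𝕊 3} {k : 𝕊 1 → 𝕊 3}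

/-- Points of a tube `ν : S¹ × ℝ² → S³` (injective, with core `k = ν (·, 0)`) off the zero section
miss the core curve. [folklore] -/
theorem tube_apply_notMem_range (hνi : Injective ν) (hν0 : ∀ z, ν (z, 0) = k z)
    {z : 𝕊 1} {u : 𝔼 2} (hu : u ≠ 0) : ν (z, u) ∈ (range k)ᶜ := by
  rintro ⟨y, hy⟩
  rw [← hν0 y] at hy
  exact hu (congrArg Prod.snd (hνi hy)).symm

/-- The image under a tube of `A × S`, `0 ∉ S`, misses the core curve. [folklore] -/
theorem tube_image_prod_subset_compl_range (hνi : Injective ν) (hν0 : ∀ z, ν (z, 0) = k z)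
    (A : Set (𝕊 1)) {S : Set (𝔼 2)} (hS : (0 : 𝔼 2) ∉ S) : ν '' (A ×ˢ S) ⊆ (range k)ᶜ := by
  rintro _ ⟨⟨z, u⟩, ⟨-, hu⟩, rfl⟩
  exact tube_apply_notMem_range hνi hν0 (fun h => hS (h ▸ hu))

/-- **The complement of the core of a topological tube in `S³` has finitely generated fundamental
group.** Let `ν : S¹ × ℝ² → S³` be continuous, injective and open, with core `k = ν (·, 0)`. Then
`π₁(S³ ∖ k(S¹), x₀)` is finitely generated for every base point `x₀`.

Proof: apply `fundamentalGroup_fg_of_finite_cover_of_isSimplyConnected` to the cover of `S³ ∖ k(S¹)` by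
the sixteen *tube pieces* `ν (A_a × (H_b ∩ B(0, 2)))` (`A_a ⊆ S¹` the four open coordinate
half-circles, `H_b ⊆ ℝ²` the four open coordinate half-planes) together with finitely many *far
balls* `B(c, δ)` centred on the compact set `C = S³ ∖ ν (S¹ × B(0, 1))`, where `3δ ≤ 1` is at most a
Lebesgue number of the open cover of `C` by `S³ ∖ ν (S¹ × B̄(0, 2))` and the enlarged pieces
`ν (A_a × (H_b ∩ B(0, 3)))`. All pieces are open (`ν` is open), path connected and miss `k(S¹)`.
Containers: two meeting tube pieces `ν (A_a × …)`, `ν (A_a' × …)` share a point `ν (z, u)`, and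
both lie in `ν ((S¹ ∖ {-z}) × ((H_b ∪ H_b') ∩ B(0, 3)))`, the homeomorphic image (`ν` is an
embedding) of the product of a contractible cap and a set star-shaped about `u`; a far ball meeting
a tube piece has `B(c, 3δ)` inside an enlarged piece (it cannot lie in `S³ ∖ ν (S¹ × B̄(0, 2))`),
and the same container works; two meeting far balls lie in `B(c, 3δ)`, a contractible cap inside
some member of the cover of `C`, hence inside `S³ ∖ k(S¹)`. All containers are contractible, in particular simply connected.
[folklore] -/
theorem fundamentalGroup_fg_compl_range_of_tube (hνc : Continuous ν) (hνi : Injective ν)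
    (hνo : IsOpenMap ν) (hν0 : ∀ z, ν (z, 0) = k z) (x₀ : ↥((range k)ᶜ)) :
    Group.FG (FundamentalGroup ↥((range k)ᶜ) x₀) := by
  classical
  have hemb : IsEmbedding ν :=
    (IsOpenEmbedding.of_continuous_injective_isOpenMap hνc hνi hνo).isEmbedding
  /- (a) coordinate half-planes `HP d ⊆ ℝ²` and half-circles `HC d ⊆ S¹`, `d : Fin 2 × Fin 2` -/
  let e : Fin 2 × Fin 2 → 𝔼 2 := fun d => EuclideanSpace.single d.1 (if d.2 = 0 then (1 : ℝ) else -1)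
  have he : ∀ d, ‖e d‖ = 1 := norm_single_sign
  let HP : Fin 2 × Fin 2 → Set (𝔼 2) := fun d => {u | 0 < ⟪u, e d⟫}
  let HC : Fin 2 × Fin 2 → Set (𝕊 1) := fun d => {z | 0 < ⟪(z : 𝔼 2), e d⟫}
  have hHP0 : ∀ d, (0 : 𝔼 2) ∉ HP d := fun d => by simp [HP]
  have hHPo : ∀ d, IsOpen (HP d) := fun d => isOpen_setOf_inner_pos (e d)
  have hHCo : ∀ d, IsOpen (HC d) := fun d => (hHPo d).preimage continuous_subtype_val
  have hHCc : ∀ d, IsPathConnected (HC d) := fun d => by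
    have := isPathConnected_sphereCap (V := 𝔼 2) (he d) (s₀ := 0) (by norm_num) (by norm_num)
    simpa only [HC] using this
  have heHP : ∀ d, e d ∈ HP d := fun d => by
    show 0 < ⟪e d, e d⟫
    rw [real_inner_self_eq_norm_sq, he]; norm_num
  have hexHP : ∀ u : 𝔼 2, u ≠ 0 → ∃ d, u ∈ HP d := fun u hu => exists_inner_single_pos hu
  have hexHC : ∀ z : 𝕊 1, ∃ d, z ∈ HC d := fun z =>
    exists_inner_single_pos (ne_zero_of_mem_unit_sphere z)
  /- (b) tube pieces `piece a b r = ν (HC a × (HP b ∩ B(0, r)))` and containers -/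
  let piece : Fin 2 × Fin 2 → Fin 2 × Fin 2 → ℝ → Set (𝕊 3) := fun a b r =>
    ν '' (HC a ×ˢ (HP b ∩ Metric.ball 0 r))
  let cont : 𝕊 1 → Fin 2 × Fin 2 → Fin 2 × Fin 2 → Set (𝕊 3) := fun z b b' =>
    ν '' ({w : 𝕊 1 | -1 < ⟪(w : 𝔼 2), (z : 𝔼 2)⟫} ×ˢ ((HP b ∪ HP b') ∩ Metric.ball 0 3))
  have hpiece_o : ∀ a b r, IsOpen (piece a b r) := fun a b r =>
    hνo _ ((hHCo a).prod ((hHPo b).inter Metric.isOpen_ball))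
  have hpiece_c : ∀ a b {r : ℝ}, 1 < r → IsPathConnected (piece a b r) := fun a b r hr => by
    refine ((hHCc a).prod ?_).image hνc
    refine ((convex_setOf_inner_pos (e b)).inter (convex_ball 0 r)).isPathConnected ⟨e b, heHP b, ?_⟩
    rw [Metric.mem_ball, dist_zero_right, he]; exact hr
  have hpiece_U : ∀ a b r, piece a b r ⊆ (range k)ᶜ := fun a b r =>
    tube_image_prod_subset_compl_range hνi hν0 _ fun h => hHP0 b h.1
  have hpiece_cont : ∀ {a b b' b'' : Fin 2 × Fin 2} {z : 𝕊 1} {r : ℝ}, z ∈ HC a →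
      (b'' = b ∨ b'' = b') → r ≤ 3 → piece a b'' r ⊆ cont z b b' := by
    intro a b b' b'' z r hz hb hr
    refine image_mono (prod_mono (fun x hx => neg_one_lt_inner_of_inner_pos hx hz) ?_)
    rintro u ⟨hu, hur⟩
    refine ⟨?_, Metric.ball_subset_ball hr hur⟩
    rcases hb with rfl | rfl
    exacts [Or.inl hu, Or.inr hu]
  have hcont_U : ∀ z b b', cont z b b' ⊆ (range k)ᶜ := fun z b b' =>
    tube_image_prod_subset_compl_range hνi hν0 _ fun ⟨h, _⟩ => h.elim (hHP0 b) (hHP0 b')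
  have hcont_c : ∀ (z : 𝕊 1) {b b' : Fin 2 × Fin 2} {u : 𝔼 2}, u ∈ HP b → u ∈ HP b' → ‖u‖ < 3 →
      IsSimplyConnected (cont z b b') := by
    intro z b b' u hu hu' hu3
    haveI : ContractibleSpace ↥{w : 𝕊 1 | -1 < ⟪(w : 𝔼 2), (z : 𝔼 2)⟫} :=
      contractibleSpace_sphereCap (by simp) le_rfl (by norm_num)
    haveI : ContractibleSpace ↥((HP b ∪ HP b') ∩ Metric.ball (0 : 𝔼 2) 3) :=
      (starConvex_union_setOf_inner_pos_inter_ball hu hu' hu3).contractibleSpace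
        ⟨u, Or.inl hu, by rwa [Metric.mem_ball, dist_zero_right]⟩
    haveI : ContractibleSpace ↥({w : 𝕊 1 | -1 < ⟪(w : 𝔼 2), (z : 𝔼 2)⟫} ×ˢ
        ((HP b ∪ HP b') ∩ Metric.ball (0 : 𝔼 2) 3)) :=
      (Homeomorph.Set.prod _ _).contractibleSpace
    haveI : ContractibleSpace (cont z b b') := (hemb.homeomorphImage _).symm.contractibleSpace
    exact (inferInstance : SimplyConnectedSpace (cont z b b'))
  /- (c) the compact far region `C` and the Lebesgue number -/
  set T₁ : Set (𝕊 3) := ν '' (univ ×ˢ Metric.ball (0 : 𝔼 2) 1) with hT₁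
  have hT₁o : IsOpen T₁ := hνo _ (isOpen_univ.prod Metric.isOpen_ball)
  set C : Set (𝕊 3) := T₁ᶜ with hC
  have hCc : IsCompact C := hT₁o.isClosed_compl.isCompact
  set O : Set (𝕊 3) := (ν '' (univ ×ˢ Metric.closedBall (0 : 𝔼 2) 2))ᶜ with hO
  have hOo : IsOpen O :=
    ((isCompact_univ.prod (isCompact_closedBall 0 2)).image hνc).isClosed.isOpen_compl
  let cov : Unit ⊕ ((Fin 2 × Fin 2) × (Fin 2 × Fin 2)) → Set (𝕊 3) :=
    Sum.elim (fun _ => O) (fun ab => piece ab.1 ab.2 3)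
  have hcovo : ∀ i, IsOpen (cov i) := by
    rintro (_ | ⟨a, b⟩)
    · exact hOo
    · exact hpiece_o a b 3
  have hcovU : ∀ i, cov i ⊆ (range k)ᶜ := by
    rintro (_ | ⟨a, b⟩)
    · rintro y hy ⟨z, rfl⟩
      exact hy ⟨(z, 0), ⟨mem_univ _, Metric.mem_closedBall_self (by norm_num)⟩, hν0 z⟩
    · exact hpiece_U a b 3
  have hCcov : C ⊆ ⋃ i, cov i := by
    intro y hy
    rw [mem_iUnion]
    by_cases hyν : y ∈ ν '' (univ ×ˢ Metric.closedBall (0 : 𝔼 2) 2)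
    · obtain ⟨⟨z, u⟩, ⟨-, hu2⟩, rfl⟩ := hyν
      have hu0 : u ≠ 0 := by
        rintro rfl
        exact hy ⟨(z, 0), ⟨mem_univ _, Metric.mem_ball_self one_pos⟩, rfl⟩
      obtain ⟨b, hb⟩ := hexHP u hu0
      obtain ⟨a, ha⟩ := hexHC z
      refine ⟨Sum.inr (a, b), mem_image_of_mem ν ⟨ha, hb, ?_⟩⟩
      rw [Metric.mem_closedBall, dist_zero_right] at hu2
      rw [Metric.mem_ball, dist_zero_right]
      linarith
    · exact ⟨Sum.inl (), hyν⟩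
  obtain ⟨δ₀, hδ₀, hleb⟩ := lebesgue_number_lemma_of_metric hCc hcovo hCcov
  -- the radius of the far balls
  set δ : ℝ := min (δ₀ / 3) (1 / 3) with hδ_def
  have hδ : 0 < δ := lt_min (by linarith) (by norm_num)
  have h3δ : 3 * δ ≤ δ₀ := by
    have := min_le_left (δ₀ / 3) (1 / 3); linarith
  have h3δ' : 3 * δ ≤ 1 := by
    have := min_le_right (δ₀ / 3) (1 / 3); linarith
  obtain ⟨T, hTC, hTf, hCT⟩ := finite_cover_balls_of_compact hCc hδ
  haveI : Finite T := hTf.to_subtype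
  /- (d) the pieces of the cover of `S³ ∖ k(S¹)` -/
  let W : ((Fin 2 × Fin 2) × (Fin 2 × Fin 2)) ⊕ T → Set (𝕊 3) :=
    Sum.elim (fun ab => piece ab.1 ab.2 2) (fun c => Metric.ball (c : 𝕊 3) δ)
  -- near pieces avoid `O`
  have hnearO : ∀ a b, piece a b 2 ⊆ Oᶜ := by
    rintro a b _ ⟨⟨z, u⟩, ⟨-, -, hu2⟩, rfl⟩
    simp only [hO, compl_compl]
    exact ⟨(z, u), ⟨mem_univ _, Metric.ball_subset_closedBall hu2⟩, rfl⟩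
  -- far balls, tripled, lie in a member of the cover of `C`
  have hfar : ∀ c : T, ∃ i, Metric.ball (c : 𝕊 3) (3 * δ) ⊆ cov i := fun c => by
    obtain ⟨i, hi⟩ := hleb c (hTC c.2)
    exact ⟨i, (Metric.ball_subset_ball h3δ).trans hi⟩
  -- containers for a near piece meeting a far ball
  have hNF : ∀ (ab : (Fin 2 × Fin 2) × (Fin 2 × Fin 2)) (c : T),
      (W (Sum.inl ab) ∩ W (Sum.inr c)).Nonempty →
      ∃ R : Set (𝕊 3), W (Sum.inl ab) ∪ W (Sum.inr c) ⊆ R ∧ R ⊆ (range k)ᶜ ∧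
        IsSimplyConnected R := by
    rintro ⟨a, b⟩ c ⟨p, hp, hp'⟩
    simp only [W, Sum.elim_inl, Sum.elim_inr] at hp hp' ⊢
    obtain ⟨i, hi⟩ := hfar c
    have hpc : p ∈ cov i := hi (Metric.ball_subset_ball (by linarith) hp')
    rcases i with _ | ⟨a', b'⟩
    · exact absurd hpc (hnearO a b hp)
    · simp only [cov, Sum.elim_inr] at hpc hi
      obtain ⟨⟨z, u⟩, ⟨hz, hu, hu2⟩, rfl⟩ := hp
      obtain ⟨⟨z', u'⟩, ⟨hz', hu', hu3⟩, he'⟩ := hpc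
      obtain ⟨hzz, huu⟩ := Prod.mk.inj (hνi he')
      rw [hzz] at hz'
      rw [huu] at hu' hu3
      refine ⟨cont z b b', union_subset ?_ ?_, hcont_U _ _ _, ?_⟩
      · exact hpiece_cont hz (Or.inl rfl) (by norm_num)
      · exact ((Metric.ball_subset_ball (by linarith)).trans hi).trans
          (hpiece_cont hz' (Or.inr rfl) le_rfl)
      · rw [Metric.mem_ball, dist_zero_right] at hu3
        exact hcont_c z hu hu' hu3
  /- (e) apply the finite-cover generation theorem -/
  refine Literature.AlgebraicTopology.FundamentalGroup.fundamentalGroup_fg_of_finite_cover_of_isSimplyConnected (U := (range k)ᶜ) W ?_ ?_ ?_ ?_ ?_ x₀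
  · -- open
    rintro (⟨a, b⟩ | c)
    · exact hpiece_o a b 2
    · exact Metric.isOpen_ball
  · -- inside `S³ ∖ k(S¹)`
    rintro (⟨a, b⟩ | c)
    · exact hpiece_U a b 2
    · obtain ⟨i, hi⟩ := hfar c
      exact ((Metric.ball_subset_ball (by linarith)).trans hi).trans (hcovU i)
  · -- path connected
    rintro (⟨a, b⟩ | c)
    · exact hpiece_c a b one_lt_two
    · exact isPathConnected_ball_sphere _ hδ (by linarith)
  · -- cover
    intro y hy
    rw [mem_iUnion]
    by_cases hyT : y ∈ T₁
    · obtain ⟨⟨z, u⟩, ⟨-, hu1⟩, rfl⟩ := hyT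
      have hu0 : u ≠ 0 := by
        rintro rfl
        exact hy ⟨z, (hν0 z).symm⟩
      obtain ⟨b, hb⟩ := hexHP u hu0
      obtain ⟨a, ha⟩ := hexHC z
      exact ⟨Sum.inl (a, b), mem_image_of_mem ν ⟨ha, hb, Metric.ball_subset_ball one_le_two hu1⟩⟩
    · obtain ⟨c, hc, hyc⟩ := mem_iUnion₂.1 (hCT hyT)
      exact ⟨Sum.inr ⟨c, hc⟩, hyc⟩
  · -- containers
    rintro (ab | c) (ab' | c') hne
    · -- near / near
      obtain ⟨a, b⟩ := ab
      obtain ⟨a', b'⟩ := ab'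
      obtain ⟨p, hp, hp'⟩ := hne
      simp only [W, Sum.elim_inl] at hp hp' ⊢
      obtain ⟨⟨z, u⟩, ⟨hz, hu, hu2⟩, rfl⟩ := hp
      obtain ⟨⟨z', u'⟩, ⟨hz', hu', hu2'⟩, he'⟩ := hp'
      obtain ⟨hzz, huu⟩ := Prod.mk.inj (hνi he')
      rw [hzz] at hz'
      rw [huu] at hu' hu2'
      refine ⟨cont z b b', union_subset ?_ ?_, hcont_U _ _ _, ?_⟩
      · exact hpiece_cont hz (Or.inl rfl) (by norm_num)
      · exact hpiece_cont hz' (Or.inr rfl) (by norm_num)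
      · rw [Metric.mem_ball, dist_zero_right] at hu2
        exact hcont_c z hu hu' (by linarith)
    · exact hNF ab c' hne
    · obtain ⟨R, hR, hRU, hRc⟩ := hNF ab' c (by rwa [inter_comm] at hne)
      exact ⟨R, by rwa [union_comm] at hR, hRU, hRc⟩
    · -- far / far
      obtain ⟨p, hp, hp'⟩ := hne
      simp only [W, Sum.elim_inr] at hp hp' ⊢
      obtain ⟨i, hi⟩ := hfar c
      haveI := contractibleSpace_ball_sphere (c : 𝕊 3) (r := 3 * δ) (by linarith) (by linarith)
      refine ⟨Metric.ball (c : 𝕊 3) (3 * δ), union_subset (Metric.ball_subset_ball (by linarith))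
        ?_, hi.trans (hcovU i),
        (inferInstance : SimplyConnectedSpace (Metric.ball (c : 𝕊 3) (3 * δ)))⟩
      intro y hy
      rw [Metric.mem_ball] at hp hp' hy ⊢
      calc dist y (c : 𝕊 3) ≤ dist y (c' : 𝕊 3) + dist p (c' : 𝕊 3) + dist p (c : 𝕊 3) := by
            have := dist_triangle y (c' : 𝕊 3) (c : 𝕊 3)
            have := dist_triangle (c' : 𝕊 3) p (c : 𝕊 3)
            rw [dist_comm (c' : 𝕊 3) p] at this
            linarith
        _ < δ + δ + δ := by gcongr
        _ = 3 * δ := by ring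

end Tube

/-! ## Knot groups from a tubular neighbourhood -/

section KnotGroup

/-- Local notation: `𝔼 n` is the model Euclidean space `EuclideanSpace ℝ (Fin n)`. -/
local notation "𝔼 " n:arg => EuclideanSpace ℝ (Fin n)

/-- Local notation: `𝕊 n` is the unit sphere in `EuclideanSpace ℝ (Fin (n + 1))`. -/
local notation "𝕊 " n:arg => (Metric.sphere (0 : EuclideanSpace ℝ (Fin (n + 1))) 1)

/-- A tubular neighbourhood `ν : S¹ × ℝ² → S³` of a knot is an **open map**: it is a smooth
embedding between manifolds of the same dimension `1 + 2 = 3`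
(`Manifold.IsSmoothEmbedding.isOpenMap_of_finrank_eq`, invariance of domain for immersions,
`GluckTwistProofs.lean`). [folklore] -/
protected theorem Knot.TubularNbhd.isOpenMap {K : 𝕊 1 → 𝕊 3} (ν : Knot.TubularNbhd K) :
    IsOpenMap ν :=
  Manifold.IsSmoothEmbedding.isOpenMap_of_finrank_eq ν.isSmoothEmbedding (by simp)

/-- **The knot group of a knot admitting a tubular neighbourhood is finitely generated** (at every
base point): `fundamentalGroup_fg_compl_range_of_tube` for the continuous, injective, open map
`ν` with `ν (z, 0) = K z`. Real proof. [folklore] -/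
theorem Knot.groupFG_of_tubularNbhd {K : Knot} (ν : Knot.TubularNbhd K) (x : K.complement) :
    Group.FG (K.group x) :=
  fundamentalGroup_fg_compl_range_of_tube (ν := ⇑ν) (k := ⇑K) ν.continuous ν.injective ν.isOpenMap
    ν.coe_apply_zero x

/-- **Knot groups are finitely generated, from the existence of tubular neighbourhoods**: the named
fact `Knot.fg_group` (Crowell–Fox, Ch. VI (2.5) with Ch. I (2.1)) follows from the named fact
`Knot.nonempty_tubularNbhd` (Hirsch (1976), §4.5 Thm. 5.2). Real proof.
[cite: CrowellFox1963, Ch. VI (2.5)] -/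
theorem Knot.fg_group_of_nonempty_tubularNbhd (h : Knot.nonempty_tubularNbhd) : Knot.fg_group :=
  fun K x => (h K).elim fun ν => Knot.groupFG_of_tubularNbhd ν x

/-- **`Δ_K(1) = ±1` from the existence of tubular neighbourhoods**: the named fact
`Knot.IsAlexanderPolynomial.isUnit_eval_one` (Crowell–Fox, Ch. IX (1.1)–(1.2); Rolfsen (1976),
§8.C) follows from the named fact `Knot.nonempty_tubularNbhd` (Hirsch (1976), §4.5 Thm. 5.2), via
`Knot.fg_group_of_nonempty_tubularNbhd` and the algebraic theorem
`Knot.IsAlexanderPolynomial.isUnit_eval_one_of_fg_group` (`KnotGroupProofs.lean`,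
`AlexanderModuleTrivializer.lean`). Real proof. [cite: CrowellFox1963, Ch. IX (1.1)–(1.2)] -/
theorem Knot.IsAlexanderPolynomial.isUnit_eval_one_of_nonempty_tubularNbhd
    (h : Knot.nonempty_tubularNbhd) : Knot.IsAlexanderPolynomial.isUnit_eval_one :=
  Knot.IsAlexanderPolynomial.isUnit_eval_one_of_fg_group (Knot.fg_group_of_nonempty_tubularNbhd h)

end KnotGroup

end Literature.Topology.FourManifolds
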